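import Summits.RiemannHypothesis.RiemannHypothesis.Theses.RuelleBand
import Literature.NumberTheory.LFunctions.RiemannXi

/-!
# First lemmas for crux-ideate (ideator 3) on `AsymptoticCriticalLine` (stmt-RiemannHypothesis-2063)

Two idea cards:
* `debranges-resonance-band` — the zeros as resonances of de Branges's positive canonical
  system for the unconditional Hermite–Biehler function `E(z) = ξ(1 − iz)`;
* `reflection-kernel-negative-index` — the Krein–Langer negative index `κ(c)` of the
  `2c`-reflection kernel of `ξ` on the half-plane `re s > 1/2 + c`.

Nothing here is proved except sanity lemmas; the `def … : Prop` are the statements the cards name.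
-/

noncomputable section

open Complex Set
open scoped ComplexConjugate

namespace Summit.RiemannHypothesis.RiemannHypothesis.Cruxes.AsymptoticCriticalLine.Ideator3

open Summit.RiemannHypothesis.RiemannHypothesis.Theses.RuelleBand
open Literature.NumberTheory.LFunctions

/-! ## Card 1: de Branges resonance band -/

/-- de Branges's structure function for `ζ` (de Branges 1986; Conrey–Li 2000 §3.1):
`E(z) = ξ(1 − i z)` with the tree's `riemannXi`. -/
def xiE (z : ℂ) : ℂ := riemannXi (1 - I * z)

/-- FIRST LEMMA 1a (Hermite–Biehler, UNCONDITIONAL; de Branges 1986, Lagarias 2006 Lemma 2.x):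
`|E(conj z)| < |E(z)|` on `im z > 0`, equivalently `|ξ(s)| < |ξ(s+1)|` for `re s > 0`.
Proof route: Hadamard product `ξ(s) = ξ(0) ∏ (1 − s/ρ)` and, termwise,
`|s + 1 − ρ| > |s − ρ| ⟺ re ρ < re s + 1/2`, true for `re s > 1/2`; for `0 < re s ≤ 1/2` pair `ρ`
with `1 − conj ρ`: `|1+y−β−iu|·|y+β−iu| > |y−β−iu|·|y−1+β−iu|`-type comparison reduces to
`4y(1−β) > 0`-type inequalities using only `0 < re ρ < 1`. -/
def XiStepMonotone : Prop := ∀ s : ℂ, 0 < s.re → ‖riemannXi s‖ < ‖riemannXi (s + 1)‖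

/-- The same in de Branges's variable. -/
def XiE_HermiteBiehler : Prop := ∀ z : ℂ, 0 < z.im → ‖xiE (conj z)‖ < ‖xiE z‖

/-- FIRST LEMMA 1b (dictionary, elementary): every zero of `E` lies in the strip `−1 < im z < 0`
(i.e. is a "resonance" of the canonical system of `E`), because `E(z) = 0 ⟺ 1 − iz` is a
non-trivial zero `ρ`, `z = i(ρ − 1)`, `im z = re ρ − 1`. -/
def ResonanceStrip : Prop := ∀ z : ℂ, xiE z = 0 → -1 < z.im ∧ z.im < 0

/-- The crux in resonance language: a single resonance band at depth `1/2`. -/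
def ResonanceBand : Prop :=
  ∀ ε : ℝ, 0 < ε → {z : ℂ | xiE z = 0 ∧ ε ≤ |z.im + 1 / 2|}.Finite

/-- FIRST LEMMA 1c (dictionary): modulo the tree's named fact `riemannXi_eq_zero_iff`
(zeros of `ξ` = zeros of `ζ` in the open strip) the crux IS the band statement. -/
def BandDictionary : Prop := riemannXi_eq_zero_iff → (AsymptoticCriticalLine ↔ ResonanceBand)

/-- Sanity: the change of variables. -/
theorem one_sub_I_mul (z : ℂ) : (1 - I * z).re = 1 + z.im ∧ (1 - I * z).im = -z.re := by
  constructor <;> simp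

/-- Sanity: `1 − i z = ρ ⟺ z = i (ρ − 1)`. -/
theorem eq_iff_z (z ρ : ℂ) : 1 - I * z = ρ ↔ z = I * (ρ - 1) := by
  constructor
  · intro h; rw [← h]; ring_nf; simp [mul_comm]
  · intro h; rw [h]; ring_nf; simp

/-! ## Card 2: negative index of the reflection kernel -/

/-- FIRST LEMMA 2a (reflection symmetry, from `ξ(1−s)=ξ(s)` and `ξ(conj s) = conj ξ(s)`):
`|ξ(1/2 − c + it)| = |ξ(1/2 + c + it)|`; hence the reflection quotient
`q_c(s) = ξ(s − 2c)/ξ(s)` is unimodular on the line `re s = 1/2 + c`. -/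
def ReflectionUnimodular : Prop :=
  ∀ c t : ℝ, ‖riemannXi (1 / 2 - c + t * I)‖ = ‖riemannXi (1 / 2 + c + t * I)‖

/-- The `2c`-reflection kernel of `ξ` on the half-plane `re s > 1/2 + c`
(de Branges kernel of `E_c(z) = ξ(1/2 + c − iz)` in the variable `s = 1/2 + c − iz`; the factor
`2π` is dropped). -/
def reflectionKernel (c : ℝ) (s w : ℂ) : ℂ :=
  (riemannXi s * conj (riemannXi w) - riemannXi (s - 2 * c) * conj (riemannXi (w - 2 * c))) /
    (s + conj w - 1 - 2 * c)

/-- The Hermitian form of the kernel on a finite configuration of points. -/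
def kernelForm (c : ℝ) {n : ℕ} (p : Fin n → ℂ) (v : Fin n → ℂ) : ℝ :=
  (∑ i, ∑ j, conj (v i) * reflectionKernel c (p i) (p j) * v j).re

/-- "The level-`c` reflection kernel, restricted to configurations in the half-plane `re s > a`, has at
most `κ` negative squares" (ADRS 1997 §1.1: no finite configuration carries a negative-definite
subspace of dimension `> κ`). The natural domain is `a = 1/2 + c`; by ADRS Thm 1.1.4 (negative
squares of a HOLOMORPHIC Hermitian kernel propagate from any subregion) the count is the same for
every `a ≥ 1/2 + c`, in particular for `a = 1 + 2c`, where `ξ(s)` AND `ξ(s − 2c)` are absolutely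
convergent Euler products. -/
def NegSquaresLEOn (a c : ℝ) (κ : ℕ) : Prop :=
  ∀ (n : ℕ) (p : Fin n → ℂ), (∀ i, a < (p i).re) →
    ∀ V : Submodule ℂ (Fin n → ℂ), (∀ v ∈ V, v ≠ 0 → kernelForm c p v < 0) →
      Module.finrank ℂ V ≤ κ

/-- The count on the natural half-plane `re s > 1/2 + c`. -/
def NegSquaresLE (c : ℝ) (κ : ℕ) : Prop := NegSquaresLEOn (1 / 2 + c) c κ

/-- FIRST LEMMA 2b′ (propagation, ADRS 1997 Thm 1.1.4 specialised): the negative-square count of the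
reflection kernel can be taken inside the half-plane of absolute convergence. -/
def PropagationToConvergenceRegion : Prop :=
  ∀ c : ℝ, 0 < c → c < 1 / 2 → ∀ κ : ℕ, (NegSquaresLE c κ ↔ NegSquaresLEOn (1 + 2 * c) c κ)

/-- The reflection quotient `q_c(s) = ξ(s − 2c)/ξ(s)` is, on `re s > 1 + 2c`, an absolutely convergent
Euler product times a Gamma ratio (sanity identity; `Complex.Gamma`, Mathlib
`riemannZeta_eulerProduct_tprod`). -/
def ReflectionQuotientEuler : Prop :=
  ∀ c : ℝ, 0 < c → ∀ s : ℂ, 1 + 2 * c < s.re →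
    riemannXi (s - 2 * c) / riemannXi s =
      ((s - 2 * c) * (s - 2 * c - 1)) / (s * (s - 1)) * (Real.pi : ℂ) ^ (c : ℂ) *
        (Complex.Gamma ((s - 2 * c) / 2) / Complex.Gamma (s / 2)) *
        ∏' p : Nat.Primes, (1 - (p : ℂ) ^ (-s)) / (1 - (p : ℂ) ^ (-(s - 2 * c)))

/-- FIRST LEMMA 2b (Krein–Langer transfer, to be proved from the generalized Hermite–Biehler /
generalized Schur factorization theorem: `q_c = S/B`, `B` Blaschke of degree `κ`): for
`0 < c < 1/2` the number of negative squares of the level-`c` reflection kernel is finite iff `ξ`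
has finitely many zeros in `re s > 1/2 + c` (and then equals their number with multiplicity). -/
def KreinLangerTransfer : Prop :=
  ∀ c : ℝ, 0 < c → c < 1 / 2 →
    ((∃ κ : ℕ, NegSquaresLE c κ) ↔ {s : ℂ | riemannXi s = 0 ∧ 1 / 2 + c < s.re}.Finite)

/-- The TRANSFER C⁺ of card 2: the crux decided inside the region of absolute convergence. -/
def ConvergenceRegionTransfer : Prop :=
  riemannXi_eq_zero_iff →
    ((∀ c : ℝ, 0 < c → c < 1 / 2 → ∃ κ : ℕ, NegSquaresLEOn (1 + 2 * c) c κ) ↔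
      AsymptoticCriticalLine)

/-- FIRST LEMMA 2c (the elementary pointwise shadow, "eventual horizontal monotonicity"):
for every `c > 0`, above some height `|ξ(σ + it)|` is non-decreasing in `σ ≥ 1/2 + c`.
`→ AsymptoticCriticalLine`: a zero `β + iγ` with `β > 1/2 + c`, `|γ| ≥ T` would force
`ξ(σ + iγ) = 0` on `[1/2 + c, β]`; `←`: Hadamard product, the finitely many exceptional zeros
contribute `O(|t|⁻²)` to `∂σ log|ξ|` against `≳ c log|t|` from the zeros near the line. -/
def EventualHorizontalMonotonicity : Prop :=
  ∀ c : ℝ, 0 < c → ∃ T : ℝ, ∀ t : ℝ, T ≤ |t| →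
    MonotoneOn (fun σ : ℝ => ‖riemannXi (σ + t * I)‖) (Ici (1 / 2 + c))

def MonotoneTransfer : Prop :=
  riemannXi_eq_zero_iff → (EventualHorizontalMonotonicity ↔ AsymptoticCriticalLine)

/-- Sanity (degenerate case recorded by the route): for `ε ≥ 1/2` the crux's set is empty. -/
theorem crux_set_empty_of_half_le {ε : ℝ} (hε : 1 / 2 ≤ ε) :
    {s : ℂ | riemannZeta s = 0 ∧ 0 < s.re ∧ s.re < 1 ∧ ε ≤ |s.re - 1 / 2|} = ∅ := by
  ext s
  simp only [mem_setOf_eq, mem_empty_iff_false, iff_false, not_and]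
  intro _ h0 h1 h2
  have : |s.re - 1 / 2| < 1 / 2 := by rw [abs_lt]; constructor <;> linarith
  linarith

end Summit.RiemannHypothesis.RiemannHypothesis.Cruxes.AsymptoticCriticalLine.Ideator3
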